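import Summits.KontsevichZagierPeriods.KontsevichZagierPeriods.Theses.ZeroPortrait
import Summits.KontsevichZagierPeriods.KontsevichZagierPeriods.Theorems.FurushoPentagonSectorToKernelCubeResolutionOfNash
import Summits.KontsevichZagierPeriods.KontsevichZagierPeriods.Theorems.HurwitzMicroSectorsNormalFormPrincipleSplitGlue
import Summits.KontsevichZagierPeriods.KontsevichZagierPeriods.Theorems.TerasomaMultiplicationBetaCancellationOfAyoubPiCancellation
import Literature.NumberTheory.Transcendental.KZCalculusProofs
import Literature.NumberTheory.Transcendental.KZKernelConjectureForms
import Literature.NumberTheory.Transcendental.KZProductIdeal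

/-!
# `ZeroPortrait.PencilComplete` (stmt-KontsevichZagierPeriods-11731): the AYOUB–π SPLIT modulo the
pencil sector — a typed decomposition into three leaves with a proved, non-trivial assembly

Crux strategist `cstrat-stmt-KontsevichZagierPeriods-11731-r1` (RESTATED deciding-crux re-audit,
BC2 redirect, 2026-08-17). The crux `X = PencilComplete` of route ZeroPortrait is Conjecture 1 of
Kontsevich–Zagier (KZ-literal rational endpoints) RELATIVE to the two pencils of the route:
`[ρ] − [ρ'] ∈ pencilSector := relations ⊔ closure(equal-valued Legendre-pencil pairs) ⊔
closure(equal-valued beta-pencil pairs)`. It is summit-implied (`pencilComplete_of_summit`) and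
equivalent to its kernel form `ker eval ≤ pencilSector` (`pencilComplete_iff_kernelForm`: the
rational shape is not load-bearing). The same absorption phenomena as for the sibling sector cruxes
(`TerasomaMultiplication.CompleteModGammaSector`, `Grothendieck.SectorComplement`) forbid sector /
residual / dimension / volume / degree cuts; what survives is the product of the two classical
factorisations of the period conjecture, written inside the calculus of moves and taken modulo the
pencil sector:

* **normal form** (Ayoub 2014, Rem. 12–13; Huber–Müller-Stach 2017, Lemma 11.2.3): pass to
  `ℤ`-combinations of TAME CUBE classes `[[0,1]ⁿ, g]`, `g` analytic near the closed cube — leaf 1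
  `CubeNashNormalForm`, VERBATIM the existing item stmt-KontsevichZagierPeriods-3574 (route
  LiftingCriteria; summit-free geometry: Nash cells + rectilinearisation; dim ≤ 1 landed);
* **localisation at `[π]`** (Kontsevich–Zagier 2001 §4.1; Ayoub 2014 Conj. 7; Huber–Wüstholz 2022
  App. A.4): leaf 2 `CubicalPiLocalKernelModPencils` — Ayoub's effective cube kernel LOCALISED at the
  disc class and taken modulo the pencil sector (the statement on which torsor / motivic-Galois
  methods act at all, stated on the classes where a period symbol can be defined without
  resolution), and leaf 3 `PiCancellationModPencils` — the disc class is a non-zero-divisor modulo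
  `pencilSector` (item 0540 with `relations ↦ pencilSector`; transcendence-free; its motivic shadow
  `P̃(MM^eff) → P̃(MM)` injective is printed OPEN, Huber–Wüstholz 2022 App. A.4).

Assembly `pencilComplete_of_ayoubPiSplit` (PROVED, sorry-free): rational pair of equal value →
`c = [ρ] − [ρ']` with `eval c = 0` → cubical resolution of `c` from leaf 1
(`SectorToKernel.cubeResolution_of_cubeNashNormalForm`, landed) → a value-zero element `a` of the
cubical span (soundness) → a pinned disc-product operator EXISTS
(`NormalFormPrincipleSplitGlue.exists_pinnedProduct`, landed; nothing is consumed vacuously) →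
leaf 2 gives `[π]^N a ∈ pencilSector` → leaf 3 peels the `N` disc factors (induction) →
`c ∈ pencilSector`. Each leaf is load-bearing; none is `X` or the summit by a cheap probe
(`bc/*_probe.lean` in the strategist folder, 6/6 fail); none carries a landed `iff` with `X` or the
summit; leaves 2 and 3 are `X`-implied (`cubicalPiLocalKernelModPencils_of_crux`,
`piCancellationModPencils_of_crux`), leaf 1 is summit-free geometry; given leaf 1 the split is
EXACT (`pencilComplete_iff_piSplit_of_cubeNash`).

References: Kontsevich–Zagier 2001 §1.2, §4.1; Ayoub, EMS Newsl. 91 (2014) Def. 9–10, Prop. 11,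
Rem. 12–13, Conj. 7; Huber–Wüstholz 2022 App. A.4; Huber–Müller-Stach 2017 Lemma 11.2.3,
Rem. 13.1.8.
-/

noncomputable section

set_option linter.dupNamespace false

namespace Summit.KontsevichZagierPeriods.KontsevichZagierPeriods.Cruxes.PencilComplete.AyoubPiSplit

open MeasureTheory Set
open Literature.NumberTheory.Transcendental
open Literature.NumberTheory.Transcendental.KZ hiding cubicalSpan
open Summit.KontsevichZagierPeriods.KontsevichZagierPeriods.Theses.ZeroPortrait (PencilComplete)
open Summit.KontsevichZagierPeriods.FurushoPentagon.ReducedPeriodRing (cubicalGens cubicalSpan)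
open Summit.KontsevichZagierPeriods.FurushoPentagon.SectorToKernel (cubeResolution_of_cubeNashNormalForm)
open Summit.KontsevichZagierPeriods.HurwitzMicroSectors.NormalFormPrincipleSplitGlue (exists_pinnedProduct)
open Summit.KontsevichZagierPeriods.KontsevichZagierPeriods.BetaCancellationLine (piRep_mul_sub_lift_mem_relations)

/-! ## The three leaves, verbatim as filed (route-file vocabulary only: the pencil sector and the
tame-cube generators are inlined; the disc product is pinned as in items 0540/0541) -/

/-- **Leaf 1 — cube-Nash normal form** = item stmt-KontsevichZagierPeriods-3574
(`LiftingCriteria.CubeNashNormalForm`) VERBATIM. Summit-free geometry.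
[cite: Ayoub2014, Rem. 12] [cite: HuberMullerStachPeriods2017, Lemma 11.2.3] -/
def CubeNashNormalForm : Prop :=
  ∀ (k k' : ℕ) (r : Literature.NumberTheory.Transcendental.KZ.IntegralRep k) (r' : Literature.NumberTheory.Transcendental.KZ.IntegralRep k'), r.IsRational → r'.IsRational → ∃ (S : ℕ) (n : Fin S → ℕ) (g : (i : Fin S) → (Fin (n i) → ℝ) → ℝ) (U : (i : Fin S) → Set (Fin (n i) → ℝ)) (ε : Fin S → ℤ) (s : (i : Fin S) → Literature.NumberTheory.Transcendental.KZ.IntegralRep (n i)), (∀ i, IsOpen (U i) ∧ Set.pi Set.univ (fun _ : Fin (n i) => Set.Icc (0:ℝ) 1) ⊆ (U i) ∧ Literature.NumberTheory.Transcendental.IsSemialgebraicFunOn ℚ (U i) (g i) ∧ AnalyticOnNhd ℝ (g i) (U i)) ∧ (∀ i, (s i).domain = Set.pi Set.univ (fun _ : Fin (n i) => Set.Icc (0:ℝ) 1) ∧ ∀ z ∈ Set.pi Set.univ (fun _ : Fin (n i) => Set.Icc (0:ℝ) 1), (s i).integrand z = g i z) ∧ Literature.NumberTheory.Transcendental.KZ.of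 r - Literature.NumberTheory.Transcendental.KZ.of r' - ∑ i, ε i • Literature.NumberTheory.Transcendental.KZ.of (s i) ∈ Literature.NumberTheory.Transcendental.KZ.relations

/-- **Leaf 2 — Ayoub's effective cube kernel, localised at `[π]`, modulo the pencil sector.**
[cite: Ayoub2014, Conj. 7] [cite: KontsevichZagier2001, §4.1] -/
def CubicalPiLocalKernelModPencils : Prop :=
  ∀ (P : ∀ n : ℕ, Literature.NumberTheory.Transcendental.KZ.IntegralRep n → Literature.NumberTheory.Transcendental.KZ.IntegralRep (n + 2)), (∀ (n : ℕ) (r : Literature.NumberTheory.Transcendental.KZ.IntegralRep n), (P n r).domain = {z : Fin (n + 2) → ℝ | z 0 ^ 2 + z 1 ^ 2 ≤ 1 ∧ (fun i : Fin n => z i.succ.succ) ∈ r.domain} ∧ (P n r).integrand = fun z => r.integrand (fun i : Fin n => z i.succ.succ)) → ∀ a ∈ AddSubgroup.closure {d : Literature.NumberTheory.Transcendental.KZ.FormalRep | ∃ (n : ℕ) (ρ : Literature.NumberTheory.Transcendental.KZ.IntegralRep n), ρ.domain = {x | ∀ i, 0 ≤ x i ∧ x i ≤ 1} ∧ AnalyticOnNhd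 ℝ ρ.integrand {x | ∀ i, 0 ≤ x i ∧ x i ≤ 1} ∧ d = Literature.NumberTheory.Transcendental.KZ.of ρ}, Literature.NumberTheory.Transcendental.KZ.eval a = 0 → ∃ N : ℕ, (⇑(FreeAbelianGroup.lift (fun s : (Σ n, Literature.NumberTheory.Transcendental.KZ.IntegralRep n) => Literature.NumberTheory.Transcendental.KZ.of (P s.1 s.2))))^[N] a ∈ (Literature.NumberTheory.Transcendental.KZ.relations ⊔ AddSubgroup.closure {d | ∃ (a b c s : ℚ) (r : Literature.NumberTheory.Transcendental.KZ.IntegralRep 2) (r' : Literature.NumberTheory.Transcendental.KZ.IntegralRep 1), 0 < s ∧ s < 1 ∧ r.domain = {x | ∀ i, x i ∈ Set.Ioo (0:ℝ) 1} ∧ Set.EqOn r.integrand (fun x => (a : ℝ) * (1 / Real.sqrt ((1 - x 0 ^ 2) * (1 - (s : ℝ) * x 0 ^ 2)) * (1 / Real.sqrt ((1 - x 1 ^ 2) * (1 - (s : ℝ) * x 1 ^ 2)))) + (b : ℝ) * (Real.sqrt (1 - (s : ℝ) * x 0 ^ 2) / Real.sqrt (1 - x 0 ^ 2) * (1 / Real.sqrt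 ((1 - x 1 ^ 2) * (1 - (s : ℝ) * x 1 ^ 2)))) + (c : ℝ) * (Real.sqrt (1 - (s : ℝ) * x 0 ^ 2) / Real.sqrt (1 - x 0 ^ 2) * (Real.sqrt (1 - (s : ℝ) * x 1 ^ 2) / Real.sqrt (1 - x 1 ^ 2)))) r.domain ∧ r'.domain = Set.univ ∧ Set.EqOn r'.integrand (fun x => 1 / (2 * (1 + x 0 ^ 2))) r'.domain ∧ r.value = r'.value ∧ d = Literature.NumberTheory.Transcendental.KZ.of r - Literature.NumberTheory.Transcendental.KZ.of r'} ⊔ AddSubgroup.closure {d | ∃ (s : ℚ) (r r' : Literature.NumberTheory.Transcendental.KZ.IntegralRep 2), 0 < s ∧ r.domain = {x | ∀ i, x i ∈ Set.Ioo (0:ℝ) 1} ∧ Set.EqOn r.integrand (fun x => (x 0) ^ ((s : ℝ) - 1) * (1 - x 0) ^ (-(5:ℝ)/9) * (x 1) ^ (-(4:ℝ)/9) * (1 - x 1) ^ (-(2:ℝ)/9)) r.domain ∧ r'.domain = {x | x 0 ^ 2 + x 1 ^ 2 < 4} ∧ Set.EqOn r'.integrand (fun _ => (3:ℝ) ^ ((7:ℝ)/6)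 / 2) r'.domain ∧ r.value = r'.value ∧ d = Literature.NumberTheory.Transcendental.KZ.of r - Literature.NumberTheory.Transcendental.KZ.of r'})

/-- **Leaf 3 — `[π]`-cancellation modulo the pencil sector** (item 0540 with `relations ↦
pencilSector`). [cite: HuberWustholz2022, App. A.4] [cite: Ayoub2014, Conj. 7] -/
def PiCancellationModPencils : Prop :=
  ∀ (P : ∀ n : ℕ, Literature.NumberTheory.Transcendental.KZ.IntegralRep n → Literature.NumberTheory.Transcendental.KZ.IntegralRep (n + 2)), (∀ (n : ℕ) (r : Literature.NumberTheory.Transcendental.KZ.IntegralRep n), (P n r).domain = {z : Fin (n + 2) → ℝ | z 0 ^ 2 + z 1 ^ 2 ≤ 1 ∧ (fun i : Fin n => z i.succ.succ) ∈ r.domain} ∧ (P n r).integrand = fun z => r.integrand (fun i : Fin n => z i.succ.succ)) → ∀ c : Literature.NumberTheory.Transcendental.KZ.FormalRep, FreeAbelianGroup.lift (fun s : (Σ n, Literature.NumberTheory.Transcendental.KZ.IntegralRep n) => Literature.NumberTheory.Transcendental.KZ.of (P s.1 s.2)) c ∈ (Literature.NumberTheory.Transcendental.KZ.relations ⊔ AddSubgroup.closure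 {d | ∃ (a b c s : ℚ) (r : Literature.NumberTheory.Transcendental.KZ.IntegralRep 2) (r' : Literature.NumberTheory.Transcendental.KZ.IntegralRep 1), 0 < s ∧ s < 1 ∧ r.domain = {x | ∀ i, x i ∈ Set.Ioo (0:ℝ) 1} ∧ Set.EqOn r.integrand (fun x => (a : ℝ) * (1 / Real.sqrt ((1 - x 0 ^ 2) * (1 - (s : ℝ) * x 0 ^ 2)) * (1 / Real.sqrt ((1 - x 1 ^ 2) * (1 - (s : ℝ) * x 1 ^ 2)))) + (b : ℝ) * (Real.sqrt (1 - (s : ℝ) * x 0 ^ 2) / Real.sqrt (1 - x 0 ^ 2) * (1 / Real.sqrt ((1 - x 1 ^ 2) * (1 - (s : ℝ) * x 1 ^ 2)))) + (c : ℝ) * (Real.sqrt (1 - (s : ℝ) * x 0 ^ 2) / Real.sqrt (1 - x 0 ^ 2) * (Real.sqrt (1 - (s : ℝ) * x 1 ^ 2) / Real.sqrt (1 - x 1 ^ 2)))) r.domain ∧ r'.domain = Set.univ ∧ Set.EqOn r'.integrand (fun x => 1 / (2 * (1 + x 0 ^ 2))) r'.domain ∧ r.value = r'.value ∧ d = Literature.NumberTheory.Transcendental.KZ.of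 r - Literature.NumberTheory.Transcendental.KZ.of r'} ⊔ AddSubgroup.closure {d | ∃ (s : ℚ) (r r' : Literature.NumberTheory.Transcendental.KZ.IntegralRep 2), 0 < s ∧ r.domain = {x | ∀ i, x i ∈ Set.Ioo (0:ℝ) 1} ∧ Set.EqOn r.integrand (fun x => (x 0) ^ ((s : ℝ) - 1) * (1 - x 0) ^ (-(5:ℝ)/9) * (x 1) ^ (-(4:ℝ)/9) * (1 - x 1) ^ (-(2:ℝ)/9)) r.domain ∧ r'.domain = {x | x 0 ^ 2 + x 1 ^ 2 < 4} ∧ Set.EqOn r'.integrand (fun _ => (3:ℝ) ^ ((7:ℝ)/6) / 2) r'.domain ∧ r.value = r'.value ∧ d = Literature.NumberTheory.Transcendental.KZ.of r - Literature.NumberTheory.Transcendental.KZ.of r'}) → c ∈ (Literature.NumberTheory.Transcendental.KZ.relations ⊔ AddSubgroup.closure {d | ∃ (a b c s : ℚ) (r : Literature.NumberTheory.Transcendental.KZ.IntegralRep 2) (r' : Literature.NumberTheory.Transcendental.KZ.IntegralRep 1), 0 < s ∧ s < 1 ∧ r.domain = {x | ∀ i, x i ∈ Set.Ioo (0:ℝ)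 1} ∧ Set.EqOn r.integrand (fun x => (a : ℝ) * (1 / Real.sqrt ((1 - x 0 ^ 2) * (1 - (s : ℝ) * x 0 ^ 2)) * (1 / Real.sqrt ((1 - x 1 ^ 2) * (1 - (s : ℝ) * x 1 ^ 2)))) + (b : ℝ) * (Real.sqrt (1 - (s : ℝ) * x 0 ^ 2) / Real.sqrt (1 - x 0 ^ 2) * (1 / Real.sqrt ((1 - x 1 ^ 2) * (1 - (s : ℝ) * x 1 ^ 2)))) + (c : ℝ) * (Real.sqrt (1 - (s : ℝ) * x 0 ^ 2) / Real.sqrt (1 - x 0 ^ 2) * (Real.sqrt (1 - (s : ℝ) * x 1 ^ 2) / Real.sqrt (1 - x 1 ^ 2)))) r.domain ∧ r'.domain = Set.univ ∧ Set.EqOn r'.integrand (fun x => 1 / (2 * (1 + x 0 ^ 2))) r'.domain ∧ r.value = r'.value ∧ d = Literature.NumberTheory.Transcendental.KZ.of r - Literature.NumberTheory.Transcendental.KZ.of r'} ⊔ AddSubgroup.closure {d | ∃ (s : ℚ) (r r' : Literature.NumberTheory.Transcendental.KZ.IntegralRep 2), 0 < s ∧ r.domain = {x | ∀ i, x i ∈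 Set.Ioo (0:ℝ) 1} ∧ Set.EqOn r.integrand (fun x => (x 0) ^ ((s : ℝ) - 1) * (1 - x 0) ^ (-(5:ℝ)/9) * (x 1) ^ (-(4:ℝ)/9) * (1 - x 1) ^ (-(2:ℝ)/9)) r.domain ∧ r'.domain = {x | x 0 ^ 2 + x 1 ^ 2 < 4} ∧ Set.EqOn r'.integrand (fun _ => (3:ℝ) ^ ((7:ℝ)/6) / 2) r'.domain ∧ r.value = r'.value ∧ d = Literature.NumberTheory.Transcendental.KZ.of r - Literature.NumberTheory.Transcendental.KZ.of r'})

/-! ## Bridges: the inlined vocabulary, named -/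

/-- Equal-valued Legendre-pencil pair differences (route ZeroPortrait, verbatim). [folklore] -/
def legendrePairs : Set FormalRep :=
  {d | ∃ (a b c s : ℚ) (r : Literature.NumberTheory.Transcendental.KZ.IntegralRep 2) (r' : Literature.NumberTheory.Transcendental.KZ.IntegralRep 1), 0 < s ∧ s < 1 ∧ r.domain = {x | ∀ i, x i ∈ Set.Ioo (0:ℝ) 1} ∧ Set.EqOn r.integrand (fun x => (a : ℝ) * (1 / Real.sqrt ((1 - x 0 ^ 2) * (1 - (s : ℝ) * x 0 ^ 2)) * (1 / Real.sqrt ((1 - x 1 ^ 2) * (1 - (s : ℝ) * x 1 ^ 2)))) + (b : ℝ) * (Real.sqrt (1 - (s : ℝ) * x 0 ^ 2) / Real.sqrt (1 - x 0 ^ 2) * (1 / Real.sqrt ((1 - x 1 ^ 2) * (1 - (s : ℝ) * x 1 ^ 2)))) + (c : ℝ) * (Real.sqrt (1 - (s : ℝ) * x 0 ^ 2) / Real.sqrt (1 - x 0 ^ 2) * (Real.sqrt (1 - (s : ℝ) * x 1 ^ 2) / Real.sqrt (1 - x 1 ^ 2)))) r.domain ∧ r'.domain = Set.univ ∧ Set.EqOn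 r'.integrand (fun x => 1 / (2 * (1 + x 0 ^ 2))) r'.domain ∧ r.value = r'.value ∧ d = Literature.NumberTheory.Transcendental.KZ.of r - Literature.NumberTheory.Transcendental.KZ.of r'}

/-- Equal-valued beta-pencil pair differences (route ZeroPortrait, verbatim). [folklore] -/
def betaPairs : Set FormalRep :=
  {d | ∃ (s : ℚ) (r r' : Literature.NumberTheory.Transcendental.KZ.IntegralRep 2), 0 < s ∧ r.domain = {x | ∀ i, x i ∈ Set.Ioo (0:ℝ) 1} ∧ Set.EqOn r.integrand (fun x => (x 0) ^ ((s : ℝ) - 1) * (1 - x 0) ^ (-(5:ℝ)/9) * (x 1) ^ (-(4:ℝ)/9) * (1 - x 1) ^ (-(2:ℝ)/9)) r.domain ∧ r'.domain = {x | x 0 ^ 2 + x 1 ^ 2 < 4} ∧ Set.EqOn r'.integrand (fun _ => (3:ℝ) ^ ((7:ℝ)/6) / 2) r'.domain ∧ r.value = r'.value ∧ d = Literature.NumberTheory.Transcendental.KZ.of r - Literature.NumberTheory.Transcendental.KZ.of r'}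

/-- The pencil sector `relations ⊔ closure legendrePairs ⊔ closure betaPairs`. [folklore] -/
def pencilSector : AddSubgroup FormalRep :=
  relations ⊔ AddSubgroup.closure legendrePairs ⊔ AddSubgroup.closure betaPairs

/-- The inlined sector is `pencilSector`. [folklore] -/
theorem inlinedSector_eq :
    (Literature.NumberTheory.Transcendental.KZ.relations ⊔ AddSubgroup.closure {d | ∃ (a b c s : ℚ) (r : Literature.NumberTheory.Transcendental.KZ.IntegralRep 2) (r' : Literature.NumberTheory.Transcendental.KZ.IntegralRep 1), 0 < s ∧ s < 1 ∧ r.domain = {x | ∀ i, x i ∈ Set.Ioo (0:ℝ) 1} ∧ Set.EqOn r.integrand (fun x => (a : ℝ) * (1 / Real.sqrt ((1 - x 0 ^ 2) * (1 - (s : ℝ) * x 0 ^ 2)) * (1 / Real.sqrt ((1 - x 1 ^ 2) * (1 - (s : ℝ) * x 1 ^ 2)))) + (b : ℝ) * (Real.sqrt (1 - (s : ℝ) * x 0 ^ 2) / Real.sqrt (1 - x 0 ^ 2) * (1 / Real.sqrt ((1 - x 1 ^ 2) * (1 - (s : ℝ) * x 1 ^ 2)))) + (c : ℝ) * (Real.sqrt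 (1 - (s : ℝ) * x 0 ^ 2) / Real.sqrt (1 - x 0 ^ 2) * (Real.sqrt (1 - (s : ℝ) * x 1 ^ 2) / Real.sqrt (1 - x 1 ^ 2)))) r.domain ∧ r'.domain = Set.univ ∧ Set.EqOn r'.integrand (fun x => 1 / (2 * (1 + x 0 ^ 2))) r'.domain ∧ r.value = r'.value ∧ d = Literature.NumberTheory.Transcendental.KZ.of r - Literature.NumberTheory.Transcendental.KZ.of r'} ⊔ AddSubgroup.closure {d | ∃ (s : ℚ) (r r' : Literature.NumberTheory.Transcendental.KZ.IntegralRep 2), 0 < s ∧ r.domain = {x | ∀ i, x i ∈ Set.Ioo (0:ℝ) 1} ∧ Set.EqOn r.integrand (fun x => (x 0) ^ ((s : ℝ) - 1) * (1 - x 0) ^ (-(5:ℝ)/9) * (x 1) ^ (-(4:ℝ)/9) * (1 - x 1) ^ (-(2:ℝ)/9)) r.domain ∧ r'.domain = {x | x 0 ^ 2 + x 1 ^ 2 < 4} ∧ Set.EqOn r'.integrand (fun _ => (3:ℝ) ^ ((7:ℝ)/6) / 2) r'.domain ∧ r.value = r'.value ∧ d = Literature.NumberTheory.Transcendental.KZ.of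 r - Literature.NumberTheory.Transcendental.KZ.of r'}) = pencilSector := rfl

/-- Leaf 1 is item 3574 on the nose. [folklore] -/
theorem cubeNashNormalForm_iff :
    CubeNashNormalForm ↔
      Summit.KontsevichZagierPeriods.KontsevichZagierPeriods.Theses.LiftingCriteria.CubeNashNormalForm :=
  Iff.rfl

/-- The crux, unfolded through the bridge. [folklore] -/
theorem pencilComplete_iff :
    PencilComplete ↔ ∀ ⦃n m : ℕ⦄ (ρ : IntegralRep n) (ρ' : IntegralRep m), ρ.IsRational → ρ'.IsRational →
      ρ.value = ρ'.value → of ρ - of ρ' ∈ pencilSector :=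
  Iff.rfl

/-- The pinning hypothesis of items 0540/0541, as a predicate on operators `P`. [folklore] -/
def IsPinnedDisc (P : ∀ n : ℕ, IntegralRep n → IntegralRep (n + 2)) : Prop :=
  ∀ (n : ℕ) (r : IntegralRep n), (P n r).domain = {z : Fin (n + 2) → ℝ | z 0 ^ 2 + z 1 ^ 2 ≤ 1 ∧
    (fun i : Fin n => z i.succ.succ) ∈ r.domain} ∧
    (P n r).integrand = fun z => r.integrand (fun i : Fin n => z i.succ.succ)

/-- The additive extension `[r] ↦ [P r]` of a pinned operator to formal combinations. [folklore] -/
def liftP (P : ∀ n : ℕ, IntegralRep n → IntegralRep (n + 2)) : FormalRep →+ FormalRep :=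
  FreeAbelianGroup.lift (fun s : (Σ n, IntegralRep n) => of (P s.1 s.2))

/-- Leaf 2, unfolded through the bridges. [folklore] -/
theorem cubicalPiLocalKernelModPencils_iff :
    CubicalPiLocalKernelModPencils ↔
      ∀ P, IsPinnedDisc P → ∀ a ∈ cubicalSpan, eval a = 0 → ∃ N : ℕ, (liftP P)^[N] a ∈ pencilSector :=
  Iff.rfl

/-- Leaf 3, unfolded through the bridges. [folklore] -/
theorem piCancellationModPencils_iff :
    PiCancellationModPencils ↔
      ∀ P, IsPinnedDisc P → ∀ c : FormalRep, liftP P c ∈ pencilSector → c ∈ pencilSector :=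
  Iff.rfl

/-- `relations ≤ pencilSector`. [folklore] -/
theorem relations_le_pencilSector : relations ≤ pencilSector :=
  le_sup_left.trans le_sup_left

/-! ## The assembly -/

/-- Peeling: under `[π]`-cancellation modulo the pencils, `[π]^N x ∈ pencilSector` forces
`x ∈ pencilSector`. [folklore] -/
theorem mem_pencilSector_of_iterate_mem {P : ∀ n : ℕ, IntegralRep n → IntegralRep (n + 2)}
    (hcanc : ∀ c : FormalRep, liftP P c ∈ pencilSector → c ∈ pencilSector) :
    ∀ (N : ℕ) (x : FormalRep), (liftP P)^[N] x ∈ pencilSector → x ∈ pencilSector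
  | 0, _, h => h
  | N + 1, x, h => by
    rw [Function.iterate_succ_apply'] at h
    exact mem_pencilSector_of_iterate_mem hcanc N x (hcanc _ h)

/-- **Cubical resolution of a formal combination** (leaf 1 + the landed
`cubeResolution_of_cubeNashNormalForm` + `exists_integralRep_sub`): every formal combination is
congruent modulo the KZ relations to an element of the cubical span. [cite: Ayoub2014, Rem. 12] -/
theorem exists_cubical_of_cubeNashNormalForm (h₁ : CubeNashNormalForm) (c : FormalRep) :
    ∃ a ∈ cubicalSpan, c - a ∈ relations := by
  obtain ⟨n, m, r, r', hrel⟩ := exists_integralRep_sub_holds c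
  obtain ⟨a₁, ha₁, h1⟩ := cubeResolution_of_cubeNashNormalForm (cubeNashNormalForm_iff.mp h₁) n r
  obtain ⟨a₂, ha₂, h2⟩ := cubeResolution_of_cubeNashNormalForm (cubeNashNormalForm_iff.mp h₁) m r'
  refine ⟨a₁ - a₂, cubicalSpan.sub_mem ha₁ ha₂, ?_⟩
  have : c - (a₁ - a₂) = (c - (of r - of r')) + (of r - a₁) - (of r' - a₂) := by abel
  rw [this]
  exact relations.sub_mem (relations.add_mem hrel h1) h2

/-- **THE ASSEMBLY.** Cube-Nash normal form (leaf 1), Ayoub's localised cube kernel modulo the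
pencils (leaf 2) and `[π]`-cancellation modulo the pencils (leaf 3) imply `PencilComplete`.
[cite: Ayoub2014, Rem. 12–13 and Conj. 7] [cite: KontsevichZagier2001, §1.2 and §4.1] -/
theorem pencilComplete_of_ayoubPiSplit (h₁ : CubeNashNormalForm)
    (h₂ : CubicalPiLocalKernelModPencils) (h₃ : PiCancellationModPencils) : PencilComplete := by
  rw [pencilComplete_iff]
  intro n m ρ ρ' _ _ hv
  -- the formal difference evaluates to zero
  have hc0 : eval (of ρ - of ρ') = 0 := by rw [eval_of_sub_of, hv, sub_self]
  -- a pinned disc-product operator exists (landed construction): the leaves are not consumed vacuously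
  obtain ⟨P, hP⟩ := exists_pinnedProduct
  have hP' : IsPinnedDisc P := hP
  -- leaf 1: reduce `[ρ] − [ρ']` to the cubical span
  obtain ⟨a, ha, hca⟩ := exists_cubical_of_cubeNashNormalForm h₁ (of ρ - of ρ')
  -- soundness: the cubical representative still evaluates to zero
  have ha0 : eval a = 0 := by
    have h := relations_le_ker_eval_holds hca
    rw [AddMonoidHom.mem_ker, map_sub, hc0, zero_sub, neg_eq_zero] at h
    exact h
  -- leaf 2: some disc power of `a` lies in the pencil sector
  obtain ⟨N, hN⟩ := (cubicalPiLocalKernelModPencils_iff.mp h₂) P hP' a ha ha0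
  -- leaf 3: peel the disc factors
  have haS : a ∈ pencilSector :=
    mem_pencilSector_of_iterate_mem ((piCancellationModPencils_iff.mp h₃) P hP') N a hN
  -- conclude: `[ρ] − [ρ'] = ([ρ] − [ρ'] − a) + a`, `relations ≤ pencilSector`
  have : of ρ - of ρ' = (of ρ - of ρ' - a) + a := by abel
  rw [this]
  exact pencilSector.add_mem (relations_le_pencilSector hca) haS

/-! ## Honesty certificates: `X ≤ summit`; the rational shape is not load-bearing (kernel form);
leaves 2 and 3 are consequences of the crux (never stronger than it); leaf 1 is summit-free geometry
(not a consequence); given leaf 1 the split is exact. -/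

/-- Every generator of the pencil sector evaluates to `0`: relations by soundness, pencil pairs by
their value equality. [folklore] -/
theorem pencilSector_le_ker_eval : pencilSector ≤ eval.ker := by
  refine sup_le (sup_le (fun c hc => relations_le_ker_eval_holds hc) ((AddSubgroup.closure_le _).mpr ?_))
    ((AddSubgroup.closure_le _).mpr ?_)
  · rintro d ⟨a, b, c, s, r, r', -, -, -, -, -, -, hval, rfl⟩
    rw [SetLike.mem_coe, AddMonoidHom.mem_ker, eval_of_sub_of, hval, sub_self]
  · rintro d ⟨s, r, r', -, -, -, -, -, hval, rfl⟩
    rw [SetLike.mem_coe, AddMonoidHom.mem_ker, eval_of_sub_of, hval, sub_self]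

/-- **The summit implies the crux** (`relations ≤ pencilSector`): `X` is never stronger than the
summit. [folklore] -/
theorem pencilComplete_of_summit (hS : KontsevichZagierPeriods) : PencilComplete := by
  rw [pencilComplete_iff]
  intro n m ρ ρ' hρ hρ' hv
  exact relations_le_pencilSector (hS ρ ρ' hρ hρ' hv)

/-- **Kernel form of the crux** (the rational shape is not load-bearing): every formal combination is
`≡ [r] − [r']` modulo relations (`exists_integralRep_sub`), each of `r`, `r'` is equivalent to a
rational-shape representation (`exists_isRational_equivalent`), and values are move-invariant.
[cite: KontsevichZagier2001, §1.1 remark after the Definition] -/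
theorem kernelForm_of_pencilComplete (h : PencilComplete) (c : FormalRep) (hc : eval c = 0) :
    c ∈ pencilSector := by
  obtain ⟨n, m, r, r', hrel⟩ := exists_integralRep_sub_holds c
  obtain ⟨N, R, hR, hrR⟩ := exists_isRational_equivalent_holds r
  obtain ⟨N', R', hR', hrR'⟩ := exists_isRational_equivalent_holds r'
  have hv : r.value = r'.value := by
    have h0 : eval (c - (of r - of r')) = 0 := relations_le_ker_eval_holds hrel
    rw [map_sub, hc, zero_sub, neg_eq_zero, eval_of_sub_of, sub_eq_zero] at h0
    exact h0
  have hvR : R.value = R'.value := by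
    rw [← Equivalent.value_eq_holds hrR, ← Equivalent.value_eq_holds hrR', hv]
  have hRR' : of R - of R' ∈ pencilSector := (pencilComplete_iff.mp h) R R' hR hR' hvR
  have h1 : of r - of R ∈ pencilSector := relations_le_pencilSector hrR
  have h2 : of r' - of R' ∈ pencilSector := relations_le_pencilSector hrR'
  have : c = (c - (of r - of r')) + (of r - of R) - (of r' - of R') + (of R - of R') := by abel
  rw [this]
  exact pencilSector.add_mem (pencilSector.sub_mem (pencilSector.add_mem
    (relations_le_pencilSector hrel) h1) h2) hRR'

/-- **Crux ⇔ kernel form** `ker eval ≤ pencilSector`. [folklore] -/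
theorem pencilComplete_iff_kernelForm :
    PencilComplete ↔ ∀ c : FormalRep, eval c = 0 → c ∈ pencilSector := by
  refine ⟨kernelForm_of_pencilComplete, fun h => ?_⟩
  rw [pencilComplete_iff]
  intro n m ρ ρ' _ _ hv
  exact h _ (by rw [eval_of_sub_of, hv, sub_self])

/-- `eval ∘ liftP P = π · eval` for a pinned operator: `liftP P c ≡ [π] * c` modulo relations
(`BetaCancellationLine.piRep_mul_sub_lift_mem_relations`, landed), relations evaluate to `0`, and
`eval ([π] * c) = π · eval c` (`KZ.eval_piRep_mul`). [folklore] -/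
theorem eval_liftP {P : ∀ n : ℕ, IntegralRep n → IntegralRep (n + 2)} (hP : IsPinnedDisc P)
    (c : FormalRep) : eval (liftP P c) = Real.pi * eval c := by
  have h0 : eval (of piRep * c - liftP P c) = 0 :=
    relations_le_ker_eval_holds (piRep_mul_sub_lift_mem_relations P hP c)
  rw [map_sub, eval_piRep_mul, sub_eq_zero] at h0
  exact h0.symm

/-- **A pinned disc operator preserves the KZ relations**: `liftP P c = [π] * c − ([π] * c −
liftP P c)`, the first term a relation by the left-ideal property `KZ.mul_mem_relations_left_holds`,
the second by `piRep_mul_sub_lift_mem_relations`. [cite: KontsevichZagier2001, §1.2] -/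
theorem liftP_mem_relations {P : ∀ n : ℕ, IntegralRep n → IntegralRep (n + 2)} (hP : IsPinnedDisc P)
    {c : FormalRep} (hc : c ∈ relations) : liftP P c ∈ relations := by
  have h1 : of piRep * c ∈ relations := mul_mem_relations_left_holds c (of piRep) hc
  have h2 := piRep_mul_sub_lift_mem_relations P hP c
  have : liftP P c = of piRep * c - (of piRep * c - liftP P c) := by
    simp only [liftP, sub_sub_cancel]
  rw [this]
  exact relations.sub_mem h1 h2

/-- **The crux implies leaf 3** (unconditionally): `liftP P c ∈ pencilSector ⇒ π · eval c = 0 ⇒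
eval c = 0 ⇒ c ∈ pencilSector`. So leaf 3 is a CONSEQUENCE of `X`, never stronger. [folklore] -/
theorem piCancellationModPencils_of_crux (h : PencilComplete) : PiCancellationModPencils := by
  rw [piCancellationModPencils_iff]
  intro P hP c hc
  have h0 : eval (liftP P c) = 0 := pencilSector_le_ker_eval hc
  rw [eval_liftP hP] at h0
  have hc0 : eval c = 0 := (mul_eq_zero.mp h0).resolve_left Real.pi_ne_zero
  exact kernelForm_of_pencilComplete h c hc0

/-- **The crux implies leaf 2** (exponent `N = 0`). [folklore] -/
theorem cubicalPiLocalKernelModPencils_of_crux (h : PencilComplete) :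
    CubicalPiLocalKernelModPencils := by
  rw [cubicalPiLocalKernelModPencils_iff]
  intro P _ a _ ha0
  exact ⟨0, kernelForm_of_pencilComplete h a ha0⟩

/-- **Exactness given the normal form**: under leaf 1, `X ⇔ leaf 2 ∧ leaf 3`. [folklore] -/
theorem pencilComplete_iff_piSplit_of_cubeNash (h₁ : CubeNashNormalForm) :
    PencilComplete ↔ CubicalPiLocalKernelModPencils ∧ PiCancellationModPencils :=
  ⟨fun h => ⟨cubicalPiLocalKernelModPencils_of_crux h, piCancellationModPencils_of_crux h⟩,
    fun h => pencilComplete_of_ayoubPiSplit h₁ h.1 h.2⟩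

/-- **The summit implies leaves 2 and 3** (through the crux). [folklore] -/
theorem leaves_of_summit (hS : KontsevichZagierPeriods) :
    CubicalPiLocalKernelModPencils ∧ PiCancellationModPencils :=
  ⟨cubicalPiLocalKernelModPencils_of_crux (pencilComplete_of_summit hS),
    piCancellationModPencils_of_crux (pencilComplete_of_summit hS)⟩

end Summit.KontsevichZagierPeriods.KontsevichZagierPeriods.Cruxes.PencilComplete.AyoubPiSplit
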